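import Mathlib
import HarnessLib

/-!
# A local algebra with residue field `k`, nilpotent maximal ideal generated by `s₁, …, s_d` with `sᵢ^q = 0` is a quotient of
# `k[X₁, …, X_d]` and is spanned by the `q^d` monomials `s^α`, `α < q`: `dim_k B ≤ q^d`

Topic `Literature/RingTheory/MvPolynomial`, namespace `Literature.RingTheory.MvPolynomial`.  THEOREMS ONLY (no `def`, no instance,
no named fact), Mathlib only.  The multivariable cousin of ★ `PrincipalIdealRing/MonogenicLocalAlgebraTruncatedPolynomial` (`d = 1`:
`B ≅ k[X]/(Xⁿ)`), in the form of an UPPER BOUND on the `k`-dimension — the algebra behind the order bound `|H| ≤ q^{dim Lie H}` for a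
finite connected group scheme `H = Spec B` over a field killed by the `q`-power map (coordinate ring local with residue field `k`,
`𝔪` generated by `dim Lie H` elements, all `q`-th powers of elements of `𝔪` zero).

## Source (read at the page)

M. F. Atiyah, I. G. Macdonald, *Introduction to Commutative Algebra* (1969), Ch. 8: Prop. 8.8 and the Example after it (the
one-variable case: an Artin local ring with `dim_k 𝔪/𝔪² ≤ 1` has all its ideals principal, e.g. `k[x]/(xⁿ)`), with Prop. 2.8
(Nakayama: elements whose images span `M/𝔪M` generate `M`) and Cor. 8.2∕Prop. 8.6 (in an Artin local ring `𝔪` is nilpotent).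
The statement formalised — «if `𝔪 = (s₁,…,s_d)` with residue field `k`, `𝔪` nilpotent, then `k[X₁,…,X_d] → B`, `Xᵢ ↦ sᵢ`, is
surjective; if moreover `sᵢ^q = 0` then `B` is `k`-spanned by the monomials `s^α` with all `αᵢ < q`, so `dim_k B ≤ q^d`» — is the
standard consequence [folklore] (e.g. the proof of `|G| = p^{dim Lie G}` bounds for height-one group schemes); no named theorem is
claimed beyond A–M's.

## What is formalised (for `B` a commutative `k`-algebra, `k` a field, `B` local with maximal ideal `𝔪`)

Hypotheses are ELEMENTWISE and Mathlib-native: `hres : ∀ b, ∃ c : k, b - algebraMap k B c ∈ 𝔪` (the residue field is `k`),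
`s : ι → B` (`ι` finite) with `hs : Ideal.span (Set.range s) = 𝔪`, `hnil : IsNilpotent 𝔪`, `hq : ∀ i, s i ^ q = 0`.
* §0 `span_range_eq_maximalIdeal_of_sup_sq_eq` — Nakayama: `span (range s) ⊔ 𝔪² = 𝔪` with `𝔪` finitely generated gives
  `span (range s) = 𝔪` (so `s` may be taken to be any lift of a basis of `𝔪/𝔪²`).
* §1 `exists_sub_aeval_mem_maximalIdeal_pow` (`b ≡ f(s) mod 𝔪ᴺ` for every `N`) and
  **`aeval_surjective_of_span_range_eq_maximalIdeal`** — `MvPolynomial.aeval s : k[X_ι] → B` is onto.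
* §2 `aeval_X_pow_eq_zero` (`Xᵢ^q ↦ 0`), **`span_range_prod_pow_eq_top`** — `B` is `k`-spanned by the `q^{#ι}` products
  `∏ᵢ sᵢ^{αᵢ}`, `α : ι → Fin q` —, **`finite_of_span_range_eq_maximalIdeal`** and the HEAD
  **`finrank_le_pow_card_of_span_range_eq_maximalIdeal : Module.finrank k B ≤ q ^ Fintype.card ι`**;
  the one-generator corollary `finrank_le_of_maximalIdeal_eq_span_of_pow_eq_zero` (`𝔪 = (p)`, `p^q = 0` ⇒ `dim_k B ≤ q`).
An upper bound is what the consumer needs; the exact count `dim_k k[X_ι]/(Xᵢ^q) = q^{#ι}` is not formalised here.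

## Mathlib / tree search

Mathlib: `Submodule.le_of_le_smul_of_le_jacobson_bot` (Nakayama), `IsLocalRing.maximalIdeal_le_jacobson`, `Submodule.mul_induction_on`,
`Ideal.mem_span_range_iff_exists_fun`, `MvPolynomial.induction_on`, `MvPolynomial.aeval_X`∕`aeval_C`, `finrank_range_le_card`, `finrank_top`,
`Module.Finite.span_of_finite`, `Finset.mul_prod_erase`; nothing on truncated polynomial algebras
(`rg "X i \^" Mathlib/RingTheory/MvPolynomial` gives only `restrictDegree`-type submodules).  Tree: ★ `MonogenicLocalAlgebraIdeals`,
★ `MonogenicLocalAlgebraTruncatedPolynomial` (one variable), `Literature/RingTheory/MvPolynomial/*` (Gröbner∕degree files, unrelated).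
-/

open MvPolynomial

namespace Literature.RingTheory.MvPolynomial

open IsLocalRing Module

universe u v w

variable {k : Type u} [Field k] {B : Type v} [CommRing B] [Algebra k B] [IsLocalRing B] {ι : Type w}

/-! ## §0 Nakayama: lifts of generators of `𝔪/𝔪²` generate `𝔪` -/

/-- **Nakayama for the maximal ideal**: if `𝔪` is finitely generated and `span (range s) ⊔ 𝔪² = 𝔪` (the images of the `sᵢ` span the
cotangent space `𝔪/𝔪²`), then `span (range s) = 𝔪` (A–M Prop. 2.8 with `M = 𝔪`; Mathlib `Submodule.le_of_le_smul_of_le_jacobson_bot`).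
[cite: AtiyahMacdonald1969, Ch. 2, Prop. 2.8] -/
theorem span_range_eq_maximalIdeal_of_sup_sq_eq (s : ι → B) (hfg : (maximalIdeal B).FG)
    (h : Ideal.span (Set.range s) ⊔ maximalIdeal B ^ 2 = maximalIdeal B) : Ideal.span (Set.range s) = maximalIdeal B := by
  have hle : Ideal.span (Set.range s) ≤ maximalIdeal B := le_sup_left.trans h.le
  refine le_antisymm hle ?_
  refine Submodule.le_of_le_smul_of_le_jacobson_bot hfg (maximalIdeal_le_jacobson ⊥) ?_
  rw [Ideal.smul_eq_mul, ← pow_two]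
  exact h.ge

/-! ## §1 `k[X_ι] → B`, `Xᵢ ↦ sᵢ`, is onto -/

/-- Approximation: with residue field `k` (`hres`) and `𝔪 = (s_ι)`, every `x ∈ 𝔪ᴺ` is `≡ g(s) (mod 𝔪ᴺ⁺¹)` for some polynomial `g`
(induction on `N` through `𝔪ᴺ⁺¹ = 𝔪 · 𝔪ᴺ`, Mathlib `Submodule.mul_induction_on`, writing `m ∈ 𝔪` as `Σ bᵢ sᵢ`).
[cite: AtiyahMacdonald1969, Ch. 8, Prop. 8.8 (proof) and Example] -/
theorem exists_sub_aeval_mem_pow_succ_of_mem_pow [Fintype ι] (s : ι → B) (hs : Ideal.span (Set.range s) = maximalIdeal B)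
    (hres : ∀ b : B, ∃ c : k, b - algebraMap k B c ∈ maximalIdeal B) (N : ℕ) :
    ∀ x ∈ maximalIdeal B ^ N, ∃ g : MvPolynomial ι k, x - aeval s g ∈ maximalIdeal B ^ (N + 1) := by
  induction N with
  | zero =>
    intro x _
    obtain ⟨c, hc⟩ := hres x
    exact ⟨C c, by rwa [aeval_C, zero_add, pow_one]⟩
  | succ N ih =>
    intro x hx
    rw [pow_succ'] at hx
    refine Submodule.mul_induction_on hx ?_ ?_
    · intro m hm n hn
      rw [← hs] at hm
      obtain ⟨b, rfl⟩ := Ideal.mem_span_range_iff_exists_fun.1 hm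
      -- `(Σ bᵢ sᵢ) n = Σ sᵢ (bᵢ n)`, and each `bᵢ n ∈ 𝔪ᴺ` is approximated by the induction hypothesis
      choose g hg using fun i => ih (b i * n) (Ideal.mul_mem_left _ _ hn)
      refine ⟨∑ i, X i * g i, ?_⟩
      have h1 : (∑ i, b i * s i) * n - aeval s (∑ i, X i * g i) = ∑ i, s i * (b i * n - aeval s (g i)) := by
        rw [map_sum, Finset.sum_mul, ← Finset.sum_sub_distrib]
        refine Finset.sum_congr rfl fun i _ => ?_
        rw [map_mul, aeval_X]
        ring
      rw [h1, pow_succ']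
      refine Ideal.sum_mem _ fun i _ => Ideal.mul_mem_mul ?_ (hg i)
      rw [← hs]
      exact Ideal.subset_span ⟨i, rfl⟩
    · rintro x y ⟨gx, hgx⟩ ⟨gy, hgy⟩
      refine ⟨gx + gy, ?_⟩
      have h1 : x + y - aeval s (gx + gy) = (x - aeval s gx) + (y - aeval s gy) := by rw [map_add]; ring
      rw [h1]
      exact Ideal.add_mem _ hgx hgy

/-- `b ≡ f(s) (mod 𝔪ᴺ)` for every `b ∈ B` and every `N` (iterate `exists_sub_aeval_mem_pow_succ_of_mem_pow`).
[cite: AtiyahMacdonald1969, Ch. 8, Prop. 8.8 (proof) and Example] -/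
theorem exists_sub_aeval_mem_maximalIdeal_pow [Fintype ι] (s : ι → B) (hs : Ideal.span (Set.range s) = maximalIdeal B)
    (hres : ∀ b : B, ∃ c : k, b - algebraMap k B c ∈ maximalIdeal B) (b : B) (N : ℕ) :
    ∃ f : MvPolynomial ι k, b - aeval s f ∈ maximalIdeal B ^ N := by
  induction N with
  | zero => exact ⟨0, by simp⟩
  | succ N ih =>
    obtain ⟨f, hf⟩ := ih
    obtain ⟨g, hg⟩ := exists_sub_aeval_mem_pow_succ_of_mem_pow s hs hres N _ hf
    refine ⟨f + g, ?_⟩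
    have h1 : b - aeval s (f + g) = b - aeval s f - aeval s g := by rw [map_add]; ring
    rwa [h1]

/-- **`k[X_ι] → B`, `Xᵢ ↦ sᵢ`, is SURJECTIVE** for a local `k`-algebra `B` with residue field `k`, whose maximal ideal is generated by the
`sᵢ` and nilpotent: `B = k[s₁, …, s_d]` (A–M 8.8's argument «`𝔞 = 𝔪ʳ = (xʳ)`» run on elements, several variables).
[cite: AtiyahMacdonald1969, Ch. 8, Prop. 8.8 (proof) and Example] -/
theorem aeval_surjective_of_span_range_eq_maximalIdeal [Fintype ι] (s : ι → B) (hs : Ideal.span (Set.range s) = maximalIdeal B)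
    (hres : ∀ b : B, ∃ c : k, b - algebraMap k B c ∈ maximalIdeal B) (hnil : IsNilpotent (maximalIdeal B)) :
    Function.Surjective (aeval (R := k) s) := by
  intro b
  obtain ⟨N, hN⟩ := hnil
  obtain ⟨f, hf⟩ := exists_sub_aeval_mem_maximalIdeal_pow s hs hres b N
  rw [hN, Ideal.zero_eq_bot, Ideal.mem_bot, sub_eq_zero] at hf
  exact ⟨f, hf.symm⟩

/-! ## §2 The monomials `s^α`, `α < q`, span `B`: `dim_k B ≤ q^{#ι}` -/

omit [IsLocalRing B] in
/-- `Xᵢ^q ↦ sᵢ^q = 0`: the surjection `k[X_ι] → B` factors through the truncated polynomial algebra `k[X_ι]/(Xᵢ^q)`.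
[cite: AtiyahMacdonald1969, Ch. 8, Prop. 8.8 and Example] -/
theorem aeval_X_pow_eq_zero (s : ι → B) {q : ℕ} (hq : ∀ i, s i ^ q = 0) (i : ι) :
    aeval (R := k) s (X i ^ q) = 0 := by
  rw [map_pow, aeval_X, hq]

omit [IsLocalRing B] in
/-- The `k`-span of the monomials `∏ᵢ sᵢ^{αᵢ}` (`α : ι → Fin q`) is stable under multiplication by each `s n` when `s n ^ q = 0`
(raise the `n`-th exponent; if it reaches `q` the product vanishes). [cite: AtiyahMacdonald1969, Ch. 8, Prop. 8.8 and Example] -/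
theorem mul_mem_span_range_prod_pow [Fintype ι] [DecidableEq ι] (s : ι → B) {q : ℕ} (hq : ∀ i, s i ^ q = 0) (n : ι)
    {v : B} (hv : v ∈ Submodule.span k (Set.range fun α : ι → Fin q => ∏ i, s i ^ (α i : ℕ))) :
    v * s n ∈ Submodule.span k (Set.range fun α : ι → Fin q => ∏ i, s i ^ (α i : ℕ)) := by
  induction hv using Submodule.span_induction with
  | mem x hx =>
    obtain ⟨α, rfl⟩ := hx
    -- `(∏ sᵢ^{αᵢ}) · s_n = s_n^{α_n + 1} · ∏_{i ≠ n} sᵢ^{αᵢ}`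
    have hsplit : (∏ i, s i ^ (α i : ℕ)) * s n = s n ^ ((α n : ℕ) + 1) * ∏ i ∈ Finset.univ.erase n, s i ^ (α i : ℕ) := by
      rw [← Finset.mul_prod_erase Finset.univ (fun i => s i ^ (α i : ℕ)) (Finset.mem_univ n)]
      ring
    by_cases h : (α n : ℕ) + 1 < q
    · -- the raised exponent is still `< q`: another monomial of the family
      let α' : ι → Fin q := Function.update α n ⟨(α n : ℕ) + 1, h⟩
      have hα' : (∏ i, s i ^ (α' i : ℕ)) = s n ^ ((α n : ℕ) + 1) * ∏ i ∈ Finset.univ.erase n, s i ^ (α i : ℕ) := by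
        rw [← Finset.mul_prod_erase Finset.univ (fun i => s i ^ (α' i : ℕ)) (Finset.mem_univ n)]
        congr 1
        · simp [α']
        · refine Finset.prod_congr rfl fun i hi => ?_
          have hin : i ≠ n := Finset.ne_of_mem_erase hi
          simp [α', Function.update_of_ne hin]
      rw [hsplit, ← hα']
      exact Submodule.subset_span ⟨α', rfl⟩
    · -- the exponent reaches `q`: the product is `0`
      have hq' : (α n : ℕ) + 1 = q := by have := (α n).2; omega
      rw [hsplit, hq', hq n, zero_mul]
      exact Submodule.zero_mem _
  | zero => rw [zero_mul]; exact Submodule.zero_mem _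
  | add x y _ _ hx hy => rw [add_mul]; exact Submodule.add_mem _ hx hy
  | smul c x _ hx => rw [smul_mul_assoc]; exact Submodule.smul_mem _ c hx

/-- **`B` is `k`-spanned by the `q^{#ι}` monomials `∏ᵢ sᵢ^{αᵢ}`, `αᵢ < q`**, when `k[X_ι] → B` is onto and `sᵢ^q = 0`: every `f(s)` lies
in the span (induction on `f`: constants are multiples of the empty monomial, and the span is stable under `· * s n`).
[cite: AtiyahMacdonald1969, Ch. 8, Prop. 8.8 and Example] -/
theorem span_range_prod_pow_eq_top [Fintype ι] [DecidableEq ι] (s : ι → B) {q : ℕ} (hq : ∀ i, s i ^ q = 0)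
    (hsurj : Function.Surjective (aeval (R := k) s)) :
    Submodule.span k (Set.range fun α : ι → Fin q => ∏ i, s i ^ (α i : ℕ)) = ⊤ := by
  -- the zero exponent vector exists in `ι → Fin q` (if `q = 0` then `ι` is empty, as `sᵢ ^ 0 = 1 ≠ 0` in the local ring `B`)
  obtain ⟨α₀, hα₀⟩ : ∃ α : ι → Fin q, ∀ i, (α i : ℕ) = 0 := by
    rcases Nat.eq_zero_or_pos q with h0 | hpos
    · have hι : ∀ i : ι, False := fun i => one_ne_zero (by rw [← pow_zero (s i), ← h0]; exact hq i)
      exact ⟨fun i => (hι i).elim, fun i => (hι i).elim⟩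
    · exact ⟨fun _ => ⟨0, hpos⟩, fun _ => rfl⟩
  rw [eq_top_iff]
  rintro b -
  obtain ⟨f, rfl⟩ := hsurj b
  induction f using MvPolynomial.induction_on with
  | C a =>
    rw [aeval_C, Algebra.algebraMap_eq_smul_one]
    refine Submodule.smul_mem _ a (Submodule.subset_span ⟨α₀, ?_⟩)
    simp [hα₀]
  | add p q hp hq' => rw [map_add]; exact Submodule.add_mem _ hp hq'
  | mul_X p n hp => rw [map_mul, aeval_X]; exact mul_mem_span_range_prod_pow s hq n hp

/-- **`B` is finite-dimensional over `k`** under the hypotheses of `span_range_prod_pow_eq_top`. [cite: AtiyahMacdonald1969, Ch. 8, Prop. 8.8 and Example] -/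
theorem finite_of_span_range_prod_pow [Fintype ι] [DecidableEq ι] (s : ι → B) {q : ℕ} (hq : ∀ i, s i ^ q = 0)
    (hsurj : Function.Surjective (aeval (R := k) s)) : Module.Finite k B := by
  have h := span_range_prod_pow_eq_top s hq hsurj
  haveI := Module.Finite.span_of_finite k (Set.finite_range fun α : ι → Fin q => ∏ i, s i ^ (α i : ℕ))
  rw [h] at this
  exact Module.Finite.of_surjective (⊤ : Submodule k B).subtype
    (fun b => ⟨⟨b, Submodule.mem_top⟩, rfl⟩)

/-- **`dim_k B ≤ q^{#ι}`** under the hypotheses of `span_range_prod_pow_eq_top` (the spanning family is indexed by `ι → Fin q`;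
Mathlib `finrank_range_le_card`). [cite: AtiyahMacdonald1969, Ch. 8, Prop. 8.8 and Example] -/
theorem finrank_le_pow_card_of_span_range_prod_pow [Fintype ι] [DecidableEq ι] (s : ι → B) {q : ℕ} (hq : ∀ i, s i ^ q = 0)
    (hsurj : Function.Surjective (aeval (R := k) s)) : Module.finrank k B ≤ q ^ Fintype.card ι := by
  have h := span_range_prod_pow_eq_top s hq hsurj
  have hle := finrank_range_le_card (R := k) fun α : ι → Fin q => ∏ i, s i ^ (α i : ℕ)
  rw [Fintype.card_fun, Fintype.card_fin] at hle
  rw [← finrank_top, ← h]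
  exact hle

/-- **HEAD — the `q`-nil local algebra rank bound.**  Let `B` be a local `k`-algebra with residue field `k` (`hres`), maximal ideal `𝔪`
nilpotent and generated by `s : ι → B` (`ι` finite) with `sᵢ^q = 0` for all `i`.  Then `B` is finite over `k` and
**`dim_k B ≤ q ^ #ι`** (`B = k[s]` is spanned by the monomials `s^α`, `α < q`).  With `#ι = dim_k 𝔪/𝔪²` (§0) this is the bound
`|H| ≤ q^{dim Lie H}` for a connected finite `k`-group scheme `H = Spec B` killed by the `q`-power map.
[cite: AtiyahMacdonald1969, Ch. 8, Prop. 8.8 and Example] [cite: AtiyahMacdonald1969, Ch. 2, Prop. 2.8] -/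
theorem finrank_le_pow_card_of_span_range_eq_maximalIdeal [Fintype ι] (s : ι → B) (hs : Ideal.span (Set.range s) = maximalIdeal B)
    (hres : ∀ b : B, ∃ c : k, b - algebraMap k B c ∈ maximalIdeal B) (hnil : IsNilpotent (maximalIdeal B))
    {q : ℕ} (hq : ∀ i, s i ^ q = 0) :
    Module.Finite k B ∧ Module.finrank k B ≤ q ^ Fintype.card ι := by
  classical
  have hsurj := aeval_surjective_of_span_range_eq_maximalIdeal s hs hres hnil
  exact ⟨finite_of_span_range_prod_pow s hq hsurj, finrank_le_pow_card_of_span_range_prod_pow s hq hsurj⟩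

/-- **Cotangent form of the HEAD**: if `𝔪` is finitely generated and nilpotent, the residue field is `k`, and `s : ι → B` are elements
of `B` whose span together with `𝔪²` is `𝔪` (lifts of a spanning set of `𝔪/𝔪²`) with `sᵢ^q = 0`, then `dim_k B ≤ q ^ #ι`.
[cite: AtiyahMacdonald1969, Ch. 2, Prop. 2.8] [cite: AtiyahMacdonald1969, Ch. 8, Prop. 8.8 and Example] -/
theorem finrank_le_pow_card_of_span_range_sup_sq_eq [Fintype ι] (s : ι → B) (hfg : (maximalIdeal B).FG)
    (h : Ideal.span (Set.range s) ⊔ maximalIdeal B ^ 2 = maximalIdeal B)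
    (hres : ∀ b : B, ∃ c : k, b - algebraMap k B c ∈ maximalIdeal B) (hnil : IsNilpotent (maximalIdeal B))
    {q : ℕ} (hq : ∀ i, s i ^ q = 0) :
    Module.Finite k B ∧ Module.finrank k B ≤ q ^ Fintype.card ι :=
  finrank_le_pow_card_of_span_range_eq_maximalIdeal s (span_range_eq_maximalIdeal_of_sup_sq_eq s hfg h) hres hnil hq

/-- **One generator** (`d = 1`, the setting of ★ `MonogenicLocalAlgebraTruncatedPolynomial`): if `𝔪 = (p)` is nilpotent, the residue
field is `k` and `p^q = 0`, then `dim_k B ≤ q`. [cite: AtiyahMacdonald1969, Ch. 8, Prop. 8.8 and Example] -/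
theorem finrank_le_of_maximalIdeal_eq_span_of_pow_eq_zero {p : B} (hp : maximalIdeal B = Ideal.span {p})
    (hres : ∀ b : B, ∃ c : k, b - algebraMap k B c ∈ maximalIdeal B) (hnil : IsNilpotent (maximalIdeal B))
    {q : ℕ} (hq : p ^ q = 0) : Module.Finite k B ∧ Module.finrank k B ≤ q := by
  have hs : Ideal.span (Set.range fun _ : Unit => p) = maximalIdeal B := by
    rw [hp, Set.range_const]
  have h := finrank_le_pow_card_of_span_range_eq_maximalIdeal (fun _ : Unit => p) hs hres hnil (q := q) fun _ => hq
  rwa [Fintype.card_unit, pow_one] at h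

end Literature.RingTheory.MvPolynomial
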